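import Summits.QuantumFields.BalabanUV.Beta.FP.TransportFineFactor
import Summits.QuantumFields.BalabanUV.Beta.FP.PerfectSecondOrderTablesDressed
import Summits.QuantumFields.BalabanUV.Beta.FP.PerfectSecondOrderTablesTranslate
import Summits.QuantumFields.BalabanUV.Beta.FP.RoadExplicitDefect
import Summits.QuantumFields.BalabanUV.Beta.FP.SymmetryK
import Summits.QuantumFields.BalabanUV.Beta.FP.PerfectSecondOrderTablesNested
import Summits.QuantumFields.BalabanUV.Beta.FP.TadpoleFreeVertex

/-!
# `BalabanUV.Beta.FP.TransportFineFactorPerfect` — road «FP» for binder row D1, W-ORACLE-K row **TRANSPORT′** (RULING R-FP-48), THE INSTANCE AT THE PERFECT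
# COLUMN KERNEL: `C := KPerf m` (its letters DISCHARGED — (K-side) decay `StepLawKHolds`, `Lc^m`-covariance `SymmetryK.shiftK_KPerf`, `AbsMoment₂` columns
# `RoadExplicitDefect.absMoment₂_colOf_KPerf`), `n := Lc^m`, `L := Lc`, the ONE-STEP jets `V₁ := vertexOfK (G 1) Lc S∞` and `W₁ := WtInf G tabs cΛ S∞ S₂∞ 1`
# (the m = 1 carrier of record; their letters DISCHARGED from the table letters by an4's `vertexFamily_vertexOfK` ∕ `vertexOfK_translate` and my g14
# `vertexFamily₂_WtInf` ∕ `WtInf_translate`); DISPLAYED: the one-step leg `G 1` (decay + `Lc`-periodicity), the pure table letters, the second response `ψ₂`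

HONEST DEPENDENCY (page 1, mandatory): continuum YM on T⁴ ⇐ BetaPertH ∧ nine spine estimates (0/9 proved); BetaPertH ⇐ (D1) ∧ (D4) ∧ CAP+tail;
G-an2-4 gates asym, D1 and NE2/3/4.  HONEST FRAMING (cell contract, verbatim): «discharging `BetaPertH` makes Bałaban's UV stability UNCONDITIONAL —
a real constructive-QFT result; it is NOT the continuum limit and NOT the Clay problem.»  THIS MODULE is [our object] COMPOSITION BY NAME of
`TransportFineFactor.hessKer_nest_add_eq_transport_add_cross` with the K-side letters of the perfect column kernel and the table-side letters of the one-step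
carrier, (§3) the co-dressed one-step leg `G 1 := Π̂₁ᵀ·KPerf 1·Π̂₁` (its letters by my g14 `PerfectSecondOrderTablesNested`), and (§4) the leg `G 1 := KPerf 1` of R-FP-45∕46's `T₁` with ROW TAD DISCHARGED by the OWNER's `TadpoleFreeVertex` (stencil letters (St♭)(Sr) displayed, as in TAD-INST); no `def`, no `def … : Prop`, nothing cited, 0 sorry; 0∕4 row-D1 binders; NOT TRANSPORT′ for the literal yet (SLOT′ must say that the fine factor's jets ARE
`(vertexOfK (G 1) Lc S∞, WtInf … 1)` with ITS `G 1`, and `ψ₂` is (K-fm₂)'s — gan24-leaf-05 ∕ leaf-06), NOT SDF, NOT D1, NOT BetaPertH, NOT continuum, NOT Clay.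
«not in print; our bookkeeping».

ABSOLUTE RULE (cell charter, verbatim): «No internally-minted statement may enter as a cited fact. Every hypothesis is either kernel-proved in this package or a
verbatim quotation of a PUBLISHED theorem with page reference. The manuscript(s) under audit are NOT citable for their own disputed steps — they are the thing
under adjudication; programme-internal (2001/route/tribunal) claims are never citable.»

CONTENT ([our object]; `d + 1 = 4`, `2 ≤ Lc`, `1 ≤ m`):
* `biLoc_vertexOfK_one` ∕ `vertexOfK_one_translate` (the one-step vertex family `vertexOfK (G 1) Lc S∞` is localised at `Lc•u` and translation-covariant),
  `biLoc_WtInf_one` ∕ `WtInf_one_translate'` (the same for the m = 1 carrier, from my g14 letters at `m = 1`),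
* **`transport_fineFactor_KPerf`** — `hessKer (G 1) (vertexOfK (KPerf m) (Lc^m) V₁) (vertex2OfK (KPerf m) (Lc^m) W₁ + Σ_κ wsum (ψ₂ … κ) (V₁ κ)) μ ν z
  = dressedEntry (colOf (KPerf m)) (hessKer (G 1) V₁ W₁) ((Lc^m)•z) μ ν + Σ κ Σ' u ψ₂ μ 0 ν z κ u · ½·tadpole (G 1) (V₁ κ u)`,
  **`transport_fineFactor_KPerf_of_tadpoleFree`** (`tadpole (G 1) (V₁ κ u) = 0` ⇒ pure transport).
Provenance: unit `b2b-balaban-beta-d1-formalise-leaf-02` gen 15 (prover-b2b-balaban-beta-d1-formalise-leaf-02-g15-0), 2026-08-21; new file, nothing appended to others' modules.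
-/

noncomputable section

namespace Summit.QuantumFields.BalabanUV.Beta.FP.TransportFineFactorPerfect

open Finset Filter Topology
open scoped BigOperators
open Literature.MathematicalPhysics.QuantumFieldTheory.Balaban1983to89
open Literature.MathematicalPhysics.QuantumFieldTheory.Balaban1983to89.Beta
open B12Sec2to5 (l1 l1_nonneg)
open ExpKernelCalculus (Site MKer Decays BiLoc tadpole hessKer shiftK comp)
open DecimatedMomentSummable (AbsMoment₂)
open DressedMomentNormalisation (dressedEntry)
open OneStepResolventKernel (Fib wsum LocStencil)
open OneStepKernelFamily (colH vertexOfK vertexFamily_vertexOfK)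
open ResolventReflection (Φ bref vertexOfK_translate_block)
open PolarizationSign (reflSign)
open KernelReflection (refK)
open SecondOrderResponse (vertex2OfK)
open BalabanCompositeJets (LocStencil₂)
open SymmetrisedStepJets (SymTables)
open Summit.QuantumFields.BalabanUV.Beta.TameKernelCalculus (Spr)
open Summit.QuantumFields.BalabanUV.Beta.GAN24.CombesThomas (sfStep smStep)
open Summit.QuantumFields.BalabanUV.Beta.FP.PerfectObjectsT (KPerf)
open Summit.QuantumFields.BalabanUV.Beta.FP.TransportInfinityM (colOf)
open Summit.QuantumFields.BalabanUV.Beta.FP.PerfectSecondOrderTablesInf (WtInf)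
open Summit.QuantumFields.BalabanUV.Beta.FP.PerfectSecondOrderTablesDressed (vertexFamily₂_WtInf)
open Summit.QuantumFields.BalabanUV.Beta.FP.PerfectSecondOrderTablesTranslate (WtInf_translate)
open Summit.QuantumFields.BalabanUV.Beta.FP.StepLawKHolds (exists_decays_KPerf_holds)
open Summit.QuantumFields.BalabanUV.Beta.FP.SymmetryK (shiftK_KPerf)
open Summit.QuantumFields.BalabanUV.Beta.FP.RoadExplicitDefect (absMoment₂_colOf_KPerf)
open Summit.QuantumFields.BalabanUV.Beta.FP.TransportFineFactor (hessKer_nest_add_eq_transport_add_cross)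
open AffineAveraging (box toSite)
open Summit.QuantumFields.BalabanUV.Beta.TameKernelCalculus (trK)
open Summit.QuantumFields.BalabanUV.Beta.FP.NestedDressingKernel (piKSymNest)
open Summit.QuantumFields.BalabanUV.Beta.FP.PerfectSecondOrderTablesNested (exists_decays_Gnest shiftK_Gnest)
open Summit.QuantumFields.BalabanUV.Beta.FP.SymmetryKHolds (decays_KPerf_one_holds)
open Summit.QuantumFields.BalabanUV.Beta.FP.TadpoleFreeVertex (tadpole_vertexOfK_KPerf_one_eq_zero)

variable {Lc : ℕ} [NeZero Lc] {G : ℕ → MKer (3 + 1) (Fib 3)} (tabs : SymTables 3 Lc) (cΛ : ℝ)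
  {Sinf : Fin (3 + 1) → Site (3 + 1) → MKer (3 + 1) (Fib 3)}
  {S₂inf : Fin (3 + 1) → Site (3 + 1) → Fin (3 + 1) → Site (3 + 1) → MKer (3 + 1) (Fib 3)}

/-! ## §1 The one-step jets' letters at `L = Lc` -/

omit [NeZero Lc] in
/-- [folklore] The one-step vertex family through a decaying leg over local pure stencils is localised at the coarse points `Lc•u`. -/
theorem biLoc_vertexOfK_one (hG : ∃ δ C : ℝ, 0 < δ ∧ 0 ≤ C ∧ Decays (G 1) C δ) {Cs δs : ℝ} (hS : LocStencil Sinf Cs δs) (hδs : 0 < δs) :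
    ∃ Cv δv : ℝ, 0 < δv ∧ ∀ κ u, BiLoc (vertexOfK (G 1) Lc Sinf κ u) ((Lc : ℤ) • u) ((Lc : ℤ) • u) Cv δv := by
  obtain ⟨δK, C, hδK, hC, hK⟩ := hG
  have hCs : 0 ≤ Cs := (hS 0 0).nonneg (Sum.inl 0)
  have hS' : LocStencil Sinf Cs (min δs δK) := fun κ u => OneStepResolventKernel.biLoc_mono (hS κ u) hCs (min_le_left _ _)
  exact ⟨_, _, half_pos (lt_min hδs hδK), fun κ u => vertexFamily_vertexOfK (N := Lc) hK hC hS' (lt_min hδs hδK) (min_le_right _ _) κ u⟩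

omit [NeZero Lc] in
/-- [folklore] … and block-translation-covariant when the leg is `Lc`-periodic and the stencils are (St♭) block-translation-covariant (pure OR dressed stencils). -/
theorem vertexOfK_one_translate (hGcov : ∀ t : Site (3 + 1), shiftK (-((Lc : ℤ) • t)) (G 1) = G 1)
    (hSt : ∀ (κ : Fin (3 + 1)) (u t : Site (3 + 1)), Sinf κ (u + (Lc : ℤ) • t) = shiftK (-((Lc : ℤ) • t)) (Sinf κ u)) (κ : Fin (3 + 1)) (u t : Site (3 + 1)) :
    vertexOfK (G 1) Lc Sinf κ (u + t) = shiftK (-((Lc : ℤ) • t)) (vertexOfK (G 1) Lc Sinf κ u) :=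
  vertexOfK_translate_block (N := Lc) hGcov hSt κ u t

/-- [folklore] The m = 1 carrier of record is bi-localised at the coarse points (my g14 `vertexFamily₂_WtInf` at `m + 1 = 1`). -/
theorem biLoc_WtInf_one (hG : ∃ δ C : ℝ, 0 < δ ∧ 0 ≤ C ∧ Decays (G 1) C δ) {Cs δs : ℝ} (hS : LocStencil Sinf Cs δs) (hδs : 0 < δs)
    {C₂ δ₂ : ℝ} (hS₂ : LocStencil₂ S₂inf C₂ δ₂) (hδ₂ : 0 < δ₂) :
    ∃ Cw δw : ℝ, 0 < δw ∧ ∀ κ u l u', BiLoc (WtInf G tabs cΛ Sinf S₂inf 1 κ u l u') ((Lc : ℤ) • u) ((Lc : ℤ) • u') Cw δw := by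
  obtain ⟨Cw, δw, hδw, hW⟩ := vertexFamily₂_WtInf (G := G) tabs cΛ 0 hG hS hδs hS₂ hδ₂
  refine ⟨Cw, δw, hδw, fun κ u l u' => ?_⟩
  have h := hW κ u l u'
  simpa only [Nat.zero_add, zero_add, pow_one] using h

/-- [folklore] … and jointly translation-covariant (my g14 `WtInf_translate` at `m = 1`). -/
theorem WtInf_one_translate' (hGcov : ∀ t : Site (3 + 1), shiftK (-((Lc : ℤ) • t)) (G 1) = G 1)
    (hSt : ∀ (κ : Fin (3 + 1)) (u t : Site (3 + 1)), Sinf κ (u + (Lc : ℤ) • t) = shiftK (-((Lc : ℤ) • t)) (Sinf κ u))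
    (hS₂cov : ∀ (κ : Fin (3 + 1)) (u : Site (3 + 1)) (κ' : Fin (3 + 1)) (u' t : Site (3 + 1)),
      S₂inf κ (u + (Lc : ℤ) • t) κ' (u' + (Lc : ℤ) • t) = shiftK (-((Lc : ℤ) • t)) (S₂inf κ u κ' u'))
    (κ : Fin (3 + 1)) (u : Site (3 + 1)) (l : Fin (3 + 1)) (u' t : Site (3 + 1)) :
    WtInf G tabs cΛ Sinf S₂inf 1 κ (u + t) l (u' + t) = shiftK (-((Lc : ℤ) • t)) (WtInf G tabs cΛ Sinf S₂inf 1 κ u l u') := by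
  have e : (((Lc ^ 1 : ℕ) : ℤ)) = (Lc : ℤ) := by push_cast; ring
  have hG' : ∀ t : Site (3 + 1), shiftK (-((((Lc ^ 1 : ℕ) : ℤ)) • t)) (G 1) = G 1 := fun t => by rw [e]; exact hGcov t
  have hS' : ∀ (κ : Fin (3 + 1)) (u t : Site (3 + 1)),
      Sinf κ (u + (((Lc ^ 1 : ℕ) : ℤ)) • t) = shiftK (-((((Lc ^ 1 : ℕ) : ℤ)) • t)) (Sinf κ u) := fun κ u t => by rw [e]; exact hSt κ u t
  have hS₂' : ∀ (κ : Fin (3 + 1)) (u : Site (3 + 1)) (κ' : Fin (3 + 1)) (u' t : Site (3 + 1)),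
      S₂inf κ (u + (((Lc ^ 1 : ℕ) : ℤ)) • t) κ' (u' + (((Lc ^ 1 : ℕ) : ℤ)) • t) = shiftK (-((((Lc ^ 1 : ℕ) : ℤ)) • t)) (S₂inf κ u κ' u') :=
    fun κ u κ' u' t => by rw [e]; exact hS₂cov κ u κ' u' t
  have h := WtInf_translate (G := G) tabs cΛ 1 hG' hS' hS₂' κ u l u' t
  rw [e] at h
  exact h

/-! ## §2 TRANSPORT′ at the perfect column kernel -/

/-- **ROW TRANSPORT′ AT THE PERFECT COLUMN KERNEL** [our object] (`d + 1 = 4`, `2 ≤ Lc`, `1 ≤ m`; R-FP-48 «fine factor along ψ = `RP m + CROSS m`»).  With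
`V₁ := vertexOfK (G 1) Lc S∞` and `W₁ := WtInf G tabs cΛ S∞ S₂∞ 1` (the ONE-STEP jets of record), `C := KPerf … m` (K-side letters DISCHARGED), ANY one-step leg
`G 1` (decaying, `Lc`-periodic), pure table letters, and ANY coarse second response `ψ₂` (decaying from a point):
`hessKer (G 1) (vertexOfK (KPerf m) (Lc^m) V₁) (vertex2OfK (KPerf m) (Lc^m) W₁ + Σ_κ wsum (ψ₂ … κ) (V₁ κ)) μ ν z
 = dressedEntry (colOf (KPerf m)) (hessKer (G 1) V₁ W₁) ((Lc^m)•z) μ ν + Σ κ Σ' u ψ₂ μ 0 ν z κ u · (½·tadpole (G 1) (V₁ κ u))`. -/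
theorem transport_fineFactor_KPerf (hLc : 2 ≤ Lc) {m : ℕ} (hm : 1 ≤ m)
    (hG : ∃ δ C : ℝ, 0 < δ ∧ 0 ≤ C ∧ Decays (G 1) C δ) (hGcov : ∀ t : Site (3 + 1), shiftK (-((Lc : ℤ) • t)) (G 1) = G 1)
    {Cs δs : ℝ} (hS : LocStencil Sinf Cs δs) (hδs : 0 < δs)
    (hSt : ∀ (κ : Fin (3 + 1)) (u t : Site (3 + 1)), Sinf κ (u + (Lc : ℤ) • t) = shiftK (-((Lc : ℤ) • t)) (Sinf κ u))
    {C₂ δ₂ : ℝ} (hS₂ : LocStencil₂ S₂inf C₂ δ₂) (hδ₂ : 0 < δ₂)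
    (hS₂cov : ∀ (κ : Fin (3 + 1)) (u : Site (3 + 1)) (κ' : Fin (3 + 1)) (u' t : Site (3 + 1)),
      S₂inf κ (u + (Lc : ℤ) • t) κ' (u' + (Lc : ℤ) • t) = shiftK (-((Lc : ℤ) • t)) (S₂inf κ u κ' u'))
    (ψ₂ : Fin (3 + 1) → Site (3 + 1) → Fin (3 + 1) → Site (3 + 1) → Fin (3 + 1) → Site (3 + 1) → ℝ) {Cψ mψ : ℝ} (hmψ : 0 < mψ)
    (hψ : ∀ μ y ν y' κ, ∃ p : Site (3 + 1), ∀ u, |ψ₂ μ y ν y' κ u| ≤ Cψ * Real.exp (-mψ * l1 (u - p)))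
    (μ ν : Fin (3 + 1)) (z : Site (3 + 1)) :
    hessKer (G 1) (vertexOfK (KPerf (d := 3) Lc (sfStep Lc) (smStep 3 Lc) m) (Lc ^ m) (vertexOfK (G 1) Lc Sinf))
        (vertex2OfK (KPerf (d := 3) Lc (sfStep Lc) (smStep 3 Lc) m) (Lc ^ m) (WtInf G tabs cΛ Sinf S₂inf 1)
          + fun μ y ν y' => fun x z' a b => ∑ κ, wsum (ψ₂ μ y ν y' κ) (vertexOfK (G 1) Lc Sinf κ) x z' a b) μ ν z
      = dressedEntry (colOf (KPerf (d := 3) Lc (sfStep Lc) (smStep 3 Lc) m))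
          (hessKer (G 1) (vertexOfK (G 1) Lc Sinf) (WtInf G tabs cΛ Sinf S₂inf 1)) ((((Lc ^ m : ℕ) : ℤ)) • z) μ ν
        + ∑ κ, ∑' u, ψ₂ μ 0 ν z κ u * ((1 / 2 : ℝ) * tadpole (G 1) (vertexOfK (G 1) Lc Sinf κ u)) := by
  -- K-side letters of the perfect column kernel
  obtain ⟨CK, δK, hδK, hK⟩ := exists_decays_KPerf_holds (Lc := Lc) hLc hm
  have hKcov : ∀ t : Site (3 + 1), shiftK (-((((Lc ^ m : ℕ) : ℤ)) • t)) (KPerf (d := 3) Lc (sfStep Lc) (smStep 3 Lc) m)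
      = KPerf (d := 3) Lc (sfStep Lc) (smStep 3 Lc) m := fun t => shiftK_KPerf Lc (sfStep Lc) (smStep 3 Lc) m t
  have hwA : ∀ κ l : Fin 4, AbsMoment₂ (colOf (KPerf (d := 3) Lc (sfStep Lc) (smStep 3 Lc) m) κ l) := fun κ l => absMoment₂_colOf_KPerf hLc hm κ l
  -- table-side letters of the one-step jets
  obtain ⟨Cv, δv, hδv, hV⟩ := biLoc_vertexOfK_one (G := G) (Lc := Lc) hG hS hδs
  obtain ⟨Cw, δw, hδw, hW⟩ := biLoc_WtInf_one (G := G) tabs cΛ hG hS hδs hS₂ hδ₂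
  obtain ⟨δ1, C1, hδ1, -, hG1⟩ := hG
  have hn : 1 ≤ Lc ^ m := Nat.one_le_pow _ _ (Nat.pos_of_ne_zero (NeZero.ne Lc))
  have h := hessKer_nest_add_eq_transport_add_cross (L := Lc) (n := Lc ^ m) (G := G 1)
    (C := KPerf (d := 3) Lc (sfStep Lc) (smStep 3 Lc) m) (V₁ := vertexOfK (G 1) Lc Sinf) (W₁ := WtInf G tabs cΛ Sinf S₂inf 1)
    hn ⟨C1, δ1, hδ1, hG1⟩ hGcov hK hδK (fun t => by exact_mod_cast hKcov t) hwA hV hδv (vertexOfK_one_translate hGcov hSt) hW hδw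
    (WtInf_one_translate' tabs cΛ hGcov hSt hS₂cov) ψ₂ hmψ hψ μ ν z
  simpa only [Nat.cast_pow] using h

/-- **… AND WITH ROW TAD THE CROSS TERM IS GONE** [our object]: if the one-step one-point function vanishes (`tadpole (G 1) (vertexOfK (G 1) Lc S∞ κ u) = 0`, TAD-INST's
shape), the nested kernel IS the transported one-step kernel `dressedEntry (colOf (KPerf m)) (hessKer (G 1) V₁ W₁) ((Lc^m)•z) μ ν`. -/
theorem transport_fineFactor_KPerf_of_tadpoleFree (hLc : 2 ≤ Lc) {m : ℕ} (hm : 1 ≤ m)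
    (hG : ∃ δ C : ℝ, 0 < δ ∧ 0 ≤ C ∧ Decays (G 1) C δ) (hGcov : ∀ t : Site (3 + 1), shiftK (-((Lc : ℤ) • t)) (G 1) = G 1)
    {Cs δs : ℝ} (hS : LocStencil Sinf Cs δs) (hδs : 0 < δs)
    (hSt : ∀ (κ : Fin (3 + 1)) (u t : Site (3 + 1)), Sinf κ (u + (Lc : ℤ) • t) = shiftK (-((Lc : ℤ) • t)) (Sinf κ u))
    {C₂ δ₂ : ℝ} (hS₂ : LocStencil₂ S₂inf C₂ δ₂) (hδ₂ : 0 < δ₂)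
    (hS₂cov : ∀ (κ : Fin (3 + 1)) (u : Site (3 + 1)) (κ' : Fin (3 + 1)) (u' t : Site (3 + 1)),
      S₂inf κ (u + (Lc : ℤ) • t) κ' (u' + (Lc : ℤ) • t) = shiftK (-((Lc : ℤ) • t)) (S₂inf κ u κ' u'))
    (ψ₂ : Fin (3 + 1) → Site (3 + 1) → Fin (3 + 1) → Site (3 + 1) → Fin (3 + 1) → Site (3 + 1) → ℝ) {Cψ mψ : ℝ} (hmψ : 0 < mψ)
    (hψ : ∀ μ y ν y' κ, ∃ p : Site (3 + 1), ∀ u, |ψ₂ μ y ν y' κ u| ≤ Cψ * Real.exp (-mψ * l1 (u - p)))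
    (htad : ∀ κ u, tadpole (G 1) (vertexOfK (G 1) Lc Sinf κ u) = 0)
    (μ ν : Fin (3 + 1)) (z : Site (3 + 1)) :
    hessKer (G 1) (vertexOfK (KPerf (d := 3) Lc (sfStep Lc) (smStep 3 Lc) m) (Lc ^ m) (vertexOfK (G 1) Lc Sinf))
        (vertex2OfK (KPerf (d := 3) Lc (sfStep Lc) (smStep 3 Lc) m) (Lc ^ m) (WtInf G tabs cΛ Sinf S₂inf 1)
          + fun μ y ν y' => fun x z' a b => ∑ κ, wsum (ψ₂ μ y ν y' κ) (vertexOfK (G 1) Lc Sinf κ) x z' a b) μ ν z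
      = dressedEntry (colOf (KPerf (d := 3) Lc (sfStep Lc) (smStep 3 Lc) m))
          (hessKer (G 1) (vertexOfK (G 1) Lc Sinf) (WtInf G tabs cΛ Sinf S₂inf 1)) ((((Lc ^ m : ℕ) : ℤ)) • z) μ ν := by
  rw [transport_fineFactor_KPerf tabs cΛ hLc hm hG hGcov hS hδs hSt hS₂ hδ₂ hS₂cov ψ₂ hmψ hψ μ ν z]
  simp [htad]

/-! ## §3 The leg of record: `G 1 := Π̂₁ᵀ·KPerf 1·Π̂₁` (its two letters DISCHARGED) -/

/-- **ROW TRANSPORT′ AT THE PERFECT COLUMN KERNEL WITH THE CO-DRESSED ONE-STEP LEG OF RECORD** [our object] (`d + 1 = 4`, `2 ≤ Lc`, in-block root `r`, `1 ≤ m`):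
when the one-step leg IS `G 1 = Π̂₁ᵀ·KPerf 1·Π̂₁` (`Π̂₁ := piKSymNest (toSite r) Lc 1`; leaf-06's `coDressKNestAt (toSite r) Lc 1 (KPerf 1)` by `rfl`), its decay and
`Lc`-periodicity letters are DISCHARGED by my g14 `PerfectSecondOrderTablesNested.exists_decays_Gnest` ∕ `shiftK_Gnest` at `n = 1`; the pure table letters and `ψ₂`
stay displayed. -/
theorem transport_fineFactor_KPerf_Gnest (hLc : 2 ≤ Lc) {r : Fin (3 + 1) → ℕ} (hr : r ∈ box (3 + 1) Lc) {m : ℕ} (hm : 1 ≤ m)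
    (hG1 : G 1 = comp (comp (trK (piKSymNest (toSite r) Lc 1)) (KPerf (d := 3) Lc (sfStep Lc) (smStep 3 Lc) 1)) (piKSymNest (toSite r) Lc 1))
    {Cs δs : ℝ} (hS : LocStencil Sinf Cs δs) (hδs : 0 < δs)
    (hSt : ∀ (κ : Fin (3 + 1)) (u t : Site (3 + 1)), Sinf κ (u + (Lc : ℤ) • t) = shiftK (-((Lc : ℤ) • t)) (Sinf κ u))
    {C₂ δ₂ : ℝ} (hS₂ : LocStencil₂ S₂inf C₂ δ₂) (hδ₂ : 0 < δ₂)
    (hS₂cov : ∀ (κ : Fin (3 + 1)) (u : Site (3 + 1)) (κ' : Fin (3 + 1)) (u' t : Site (3 + 1)),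
      S₂inf κ (u + (Lc : ℤ) • t) κ' (u' + (Lc : ℤ) • t) = shiftK (-((Lc : ℤ) • t)) (S₂inf κ u κ' u'))
    (ψ₂ : Fin (3 + 1) → Site (3 + 1) → Fin (3 + 1) → Site (3 + 1) → Fin (3 + 1) → Site (3 + 1) → ℝ) {Cψ mψ : ℝ} (hmψ : 0 < mψ)
    (hψ : ∀ μ y ν y' κ, ∃ p : Site (3 + 1), ∀ u, |ψ₂ μ y ν y' κ u| ≤ Cψ * Real.exp (-mψ * l1 (u - p)))
    (μ ν : Fin (3 + 1)) (z : Site (3 + 1)) :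
    hessKer (G 1) (vertexOfK (KPerf (d := 3) Lc (sfStep Lc) (smStep 3 Lc) m) (Lc ^ m) (vertexOfK (G 1) Lc Sinf))
        (vertex2OfK (KPerf (d := 3) Lc (sfStep Lc) (smStep 3 Lc) m) (Lc ^ m) (WtInf G tabs cΛ Sinf S₂inf 1)
          + fun μ y ν y' => fun x z' a b => ∑ κ, wsum (ψ₂ μ y ν y' κ) (vertexOfK (G 1) Lc Sinf κ) x z' a b) μ ν z
      = dressedEntry (colOf (KPerf (d := 3) Lc (sfStep Lc) (smStep 3 Lc) m))
          (hessKer (G 1) (vertexOfK (G 1) Lc Sinf) (WtInf G tabs cΛ Sinf S₂inf 1)) ((((Lc ^ m : ℕ) : ℤ)) • z) μ ν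
        + ∑ κ, ∑' u, ψ₂ μ 0 ν z κ u * ((1 / 2 : ℝ) * tadpole (G 1) (vertexOfK (G 1) Lc Sinf κ u)) := by
  have hG : ∃ δ C : ℝ, 0 < δ ∧ 0 ≤ C ∧ Decays (G 1) C δ := by
    rw [hG1]; exact exists_decays_Gnest hLc hr le_rfl
  have hGcov : ∀ t : Site (3 + 1), shiftK (-((Lc : ℤ) • t)) (G 1) = G 1 := fun t => by
    have h := shiftK_Gnest (d := 3) (Lc := Lc) (by omega) (toSite r) (sfStep Lc) (smStep 3 Lc) 1 t
    rw [hG1]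
    simpa only [pow_one] using h
  exact transport_fineFactor_KPerf tabs cΛ hLc hm hG hGcov hS hδs hSt hS₂ hδ₂ hS₂cov ψ₂ hmψ hψ μ ν z

/-- **… AND TADPOLE-FREE** [our object]: the same with row TAD's shape at the co-dressed leg. -/
theorem transport_fineFactor_KPerf_Gnest_of_tadpoleFree (hLc : 2 ≤ Lc) {r : Fin (3 + 1) → ℕ} (hr : r ∈ box (3 + 1) Lc) {m : ℕ} (hm : 1 ≤ m)
    (hG1 : G 1 = comp (comp (trK (piKSymNest (toSite r) Lc 1)) (KPerf (d := 3) Lc (sfStep Lc) (smStep 3 Lc) 1)) (piKSymNest (toSite r) Lc 1))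
    {Cs δs : ℝ} (hS : LocStencil Sinf Cs δs) (hδs : 0 < δs)
    (hSt : ∀ (κ : Fin (3 + 1)) (u t : Site (3 + 1)), Sinf κ (u + (Lc : ℤ) • t) = shiftK (-((Lc : ℤ) • t)) (Sinf κ u))
    {C₂ δ₂ : ℝ} (hS₂ : LocStencil₂ S₂inf C₂ δ₂) (hδ₂ : 0 < δ₂)
    (hS₂cov : ∀ (κ : Fin (3 + 1)) (u : Site (3 + 1)) (κ' : Fin (3 + 1)) (u' t : Site (3 + 1)),
      S₂inf κ (u + (Lc : ℤ) • t) κ' (u' + (Lc : ℤ) • t) = shiftK (-((Lc : ℤ) • t)) (S₂inf κ u κ' u'))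
    (ψ₂ : Fin (3 + 1) → Site (3 + 1) → Fin (3 + 1) → Site (3 + 1) → Fin (3 + 1) → Site (3 + 1) → ℝ) {Cψ mψ : ℝ} (hmψ : 0 < mψ)
    (hψ : ∀ μ y ν y' κ, ∃ p : Site (3 + 1), ∀ u, |ψ₂ μ y ν y' κ u| ≤ Cψ * Real.exp (-mψ * l1 (u - p)))
    (htad : ∀ κ u, tadpole (G 1) (vertexOfK (G 1) Lc Sinf κ u) = 0)
    (μ ν : Fin (3 + 1)) (z : Site (3 + 1)) :
    hessKer (G 1) (vertexOfK (KPerf (d := 3) Lc (sfStep Lc) (smStep 3 Lc) m) (Lc ^ m) (vertexOfK (G 1) Lc Sinf))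
        (vertex2OfK (KPerf (d := 3) Lc (sfStep Lc) (smStep 3 Lc) m) (Lc ^ m) (WtInf G tabs cΛ Sinf S₂inf 1)
          + fun μ y ν y' => fun x z' a b => ∑ κ, wsum (ψ₂ μ y ν y' κ) (vertexOfK (G 1) Lc Sinf κ) x z' a b) μ ν z
      = dressedEntry (colOf (KPerf (d := 3) Lc (sfStep Lc) (smStep 3 Lc) m))
          (hessKer (G 1) (vertexOfK (G 1) Lc Sinf) (WtInf G tabs cΛ Sinf S₂inf 1)) ((((Lc ^ m : ℕ) : ℤ)) • z) μ ν := by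
  rw [transport_fineFactor_KPerf_Gnest tabs cΛ hLc hr hm hG1 hS hδs hSt hS₂ hδ₂ hS₂cov ψ₂ hmψ hψ μ ν z]
  simp [htad]

/-! ## §4 The leg of R-FP-45∕46's `T₁`: `G 1 := KPerf 1` (decay, `Lc`-periodicity AND ROW TAD DISCHARGED) -/

/-- **ROW TRANSPORT′ AT THE PERFECT COLUMN KERNEL, LEG `KPerf 1`, TADPOLE-FREE BY TAD-INST** [our object] (`d + 1 = 4`, `2 ≤ Lc`, `1 ≤ m`): when the one-step leg IS the
perfect one-step resolvent `G 1 = KPerf … 1` (R-FP-45 (B)'s placement of `T₁(b₁) := ½·tadpole (KPerf 1) (vertexOfK (KPerf 1) Lc S∞ b₁)`), its decay and `Lc`-periodicity are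
`SymmetryKHolds.decays_KPerf_one_holds` ∕ `SymmetryK.shiftK_KPerf` (UNCONDITIONAL), and for stencils with (St♭) block-translation AND (Sr) reflection covariance the cross
term VANISHES by the OWNER's TAD-INST `TadpoleFreeVertex.tadpole_vertexOfK_KPerf_one_eq_zero`:
`hessKer (KPerf 1) (vertexOfK (KPerf m) (Lc^m) V₁) (vertex2OfK (KPerf m) (Lc^m) W₁ + Σ_κ wsum (ψ₂ … κ) (V₁ κ)) μ ν z = dressedEntry (colOf (KPerf m)) (hessKer (KPerf 1) V₁ W₁) ((Lc^m)•z) μ ν`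
for EVERY decaying `ψ₂` — the transported one-step kernel and nothing else. -/
theorem transport_fineFactor_KPerf_one (hLc : 2 ≤ Lc) {m : ℕ} (hm : 1 ≤ m)
    (hG1 : G 1 = KPerf (d := 3) Lc (sfStep Lc) (smStep 3 Lc) 1)
    {Cs δs : ℝ} (hS : LocStencil Sinf Cs δs) (hδs : 0 < δs)
    (hSt : ∀ (κ : Fin (3 + 1)) (u t : Site (3 + 1)), Sinf κ (u + (Lc : ℤ) • t) = shiftK (-((Lc : ℤ) • t)) (Sinf κ u))
    (hSr : ∀ (α κ : Fin (3 + 1)) (u : Site (3 + 1)), Sinf κ (bref α κ u) = reflSign α κ • refK (Φ (d := 3) Lc α) (Sinf κ u))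
    {C₂ δ₂ : ℝ} (hS₂ : LocStencil₂ S₂inf C₂ δ₂) (hδ₂ : 0 < δ₂)
    (hS₂cov : ∀ (κ : Fin (3 + 1)) (u : Site (3 + 1)) (κ' : Fin (3 + 1)) (u' t : Site (3 + 1)),
      S₂inf κ (u + (Lc : ℤ) • t) κ' (u' + (Lc : ℤ) • t) = shiftK (-((Lc : ℤ) • t)) (S₂inf κ u κ' u'))
    (ψ₂ : Fin (3 + 1) → Site (3 + 1) → Fin (3 + 1) → Site (3 + 1) → Fin (3 + 1) → Site (3 + 1) → ℝ) {Cψ mψ : ℝ} (hmψ : 0 < mψ)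
    (hψ : ∀ μ y ν y' κ, ∃ p : Site (3 + 1), ∀ u, |ψ₂ μ y ν y' κ u| ≤ Cψ * Real.exp (-mψ * l1 (u - p)))
    (μ ν : Fin (3 + 1)) (z : Site (3 + 1)) :
    hessKer (G 1) (vertexOfK (KPerf (d := 3) Lc (sfStep Lc) (smStep 3 Lc) m) (Lc ^ m) (vertexOfK (G 1) Lc Sinf))
        (vertex2OfK (KPerf (d := 3) Lc (sfStep Lc) (smStep 3 Lc) m) (Lc ^ m) (WtInf G tabs cΛ Sinf S₂inf 1)
          + fun μ y ν y' => fun x z' a b => ∑ κ, wsum (ψ₂ μ y ν y' κ) (vertexOfK (G 1) Lc Sinf κ) x z' a b) μ ν z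
      = dressedEntry (colOf (KPerf (d := 3) Lc (sfStep Lc) (smStep 3 Lc) m))
          (hessKer (G 1) (vertexOfK (G 1) Lc Sinf) (WtInf G tabs cΛ Sinf S₂inf 1)) ((((Lc ^ m : ℕ) : ℤ)) • z) μ ν := by
  have hG : ∃ δ C : ℝ, 0 < δ ∧ 0 ≤ C ∧ Decays (G 1) C δ := by
    rw [hG1]; exact decays_KPerf_one_holds hLc
  have hGcov : ∀ t : Site (3 + 1), shiftK (-((Lc : ℤ) • t)) (G 1) = G 1 := fun t => by
    have h := shiftK_KPerf (d := 3) Lc (sfStep Lc) (smStep 3 Lc) 1 t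
    rw [hG1]
    simpa only [pow_one] using h
  have htad : ∀ κ u, tadpole (G 1) (vertexOfK (G 1) Lc Sinf κ u) = 0 := fun κ u => by
    rw [hG1]; exact tadpole_vertexOfK_KPerf_one_eq_zero hLc hS hδs hSt hSr κ u
  exact transport_fineFactor_KPerf_of_tadpoleFree tabs cΛ hLc hm hG hGcov hS hδs hSt hS₂ hδ₂ hS₂cov ψ₂ hmψ hψ htad μ ν z

end Summit.QuantumFields.BalabanUV.Beta.FP.TransportFineFactorPerfect

end
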